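import Summits.NavierStokesRegularity.NavierStokesRegularity.Theses.RellichScar
import Summits.NavierStokesRegularity.NavierStokesRegularity.Theorems.ScarRigidity.Negative.LogicAndLoadBearing
import Literature.Analysis.FluidPDE.TypeIAncientMild
import Literature.Analysis.FluidPDE.ParasiticSlabFlow
import HarnessLib

/-!
# `ScarRigidity` — line `finite-energy-log-convexity` (crux stmt-NavierStokesRegularity-11717, route RellichScar)

SKELETON of the line lead (prover-line-stmt-NavierStokesRegularity-11717-0), RESHAPED from the planner's
checked skeleton (3 stubs `stub_scarTwinFiniteEnergy` / `stub_logConvexityBelowThreshold` /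
`stub_noAnomalousExtinction`, registered 2026-08-15T23:51Z) into six stubs whose composition
`ScarRigidity_of` proves `RellichScar.ScarRigidity` BY NAME:

* `stub_apexMildRepresentative` (S1α, single profile, PDE): an apex-class suitable weak solution
  (`𝐈 < ∞`, `‖u‖ ≤ C/(‖x‖+√−t)`) has a representative `V` which is a Type-I ancient MILD solution in the
  Oseen/KNSS gauge (`IsTypeIAncientMild C V`: jointly `C^∞` on the open slab, divergence free, Duhamel formula
  between all pairs of times) with the same apex bound — bounded (on `t ≤ −δ`) weak solutions are mild modulo
  a drift (KNSS 2009 §4), and the spatial decay kills the drift.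
* `stub_apexDerivativeBounds` (S1β, single profile, PDE): a Type-I ancient mild field with the apex bound is a
  CLASSICAL solution with a Leray-gauge pressure `Q` and obeys the scale-invariant bounds
  `|∇V| ≲ (‖x‖+√−t)⁻²`, `|∇²V|, |∂ₜV|, |∇Q| ≲ (‖x‖+√−t)⁻³`, `|Q| ≲ (‖x‖+√−t)⁻²` (KNSS smoothing at the
  parabolic scale + ε-regularity at scale `‖x‖`; the pressure by Calderón–Zygmund off the diagonal).
* `stub_farFieldOfScar` (S1b, twin, elementary): same scar + `|∂ₜVᵢ| ≲ ‖x‖⁻³` ⇒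
  `‖V₁ − V₂‖ ≤ (L₁+L₂)(−t)/‖x‖³` for every `t < 0`, `x ≠ 0` (fundamental theorem of calculus from the final
  slice, where the continuous representatives agree).
* `stub_twinNorms` (S2, twin, measure theory): apex bound + far-field bound ⇒ the single majorant
  `‖V₁−V₂‖ ≤ K'(−t)/(‖x‖+√−t)³` and, by scaling `x = √(−t)·y`, the rates `‖w(t)‖₂ ≲ |t|^{1/4}`,
  `‖w(t)‖_{6/5} ≲ |t|^{3/4}`, `‖∇w(t)‖₂ ≲ |t|^{−1/4}` ("finite energy is what the scar buys").
* `stub_logConvexityBelowThreshold` (S4, twin, XL analysis): Agmon–Nirenberg log-convexity in `Ḣ⁻¹_σ`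
  (pressure-free: `‖ℙ∇·(w⊗V₁+V₂⊗w)‖_{Ḣ⁻¹} ≤ (2C/√|t|)‖w‖₂`, Riccati law `Λ̇ ≤ 2C²Λ/|t|`, so `|t|^{2C²}Λ`
  is monotone and `log ‖w‖²_{Ḣ⁻¹}` stays bounded below iff `2C² < 1`) against `‖w(t)‖_{Ḣ⁻¹} ≲ |t|^{3/4} → 0`:
  the twins coincide when `2C² < 1`. No singularity hypothesis is used.
* `stub_noAnomalousExtinction` (S5, OPEN — the residual, held by the lead): the crux on `1 ≤ 2C²`
  (`ScarRigidityAt C`), where the abstract log-convexity frame admits extinction (Miller 1974) and a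
  Navier–Stokes-specific lever acting on the parabolic core is required (TRIAGE r1-1 O3, r1-2, r1-3).

Composition: `scarRigidity_iff_pos` (Negative/LogicAndLoadBearing: only `0 < C` carries content) and a case
split on `2C² < 1`.  Disproof honoured: every stub keeps the equations, the WHOLE slab and the spatial apex
decay ((A⁺)(B⁺)(B)(C)(C″)(D) of `Cruxes/ScarRigidity/Disproof.lean`); nothing is exterior or local.
-/

noncomputable section

open Set Filter Function MeasureTheory Metric TopologicalSpace
open scoped Topology ENNReal NNReal InnerProductSpace RealInnerProductSpace
open Literature.Analysis.FluidPDE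
open Summit.NavierStokesRegularity.NavierStokesRegularity.Theses.RellichScar
open Summit.NavierStokesRegularity.NavierStokesRegularity.Theorems.ScarRigidity.Negative

set_option linter.dupNamespace false

namespace Summit.NavierStokesRegularity.NavierStokesRegularity.Theorems.RellichScarScarRigidity

/-- Physical space. -/
local notation "ℝ³" => EuclideanSpace ℝ (Fin 3)

/-- The open backward slab `(-∞,0) × ℝ³` (time first), as in the route file. -/
local notation "𝕊" => Literature.Analysis.FluidPDE.slab (EuclideanSpace ℝ (Fin 3)) (Set.Iio (0 : ℝ)) isOpen_Iio

/-! ## The stubs -/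

/-- **S1α — apex profiles are Type-I ancient mild solutions (Oseen/KNSS gauge).**  A suitable weak
solution on the slab with `𝐈 < ∞` and the apex bound `‖u‖ ≤ C/(‖x‖+√−t)` has a representative `V`
(`V = u` a.e. on the slab) which is jointly smooth on the open slab, divergence free, satisfies the
Oseen–Duhamel formula between all pairs of times `s < t < 0`, and obeys the same apex bound pointwise.
Sources: KNSS 2009 §4 (bounded weak solutions are mild modulo a parasitic drift `b(t)`; the spatial decay
forces `b = 0`), Prop. 4.1 (smoothing); tree: `AncientMildWeak`, `AncientMildDrift`,
`AncientMildRepresentative`, `KNSSLiouvilleBridge`, fact `knss2009_smoothing`. -/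
theorem stub_apexMildRepresentative :
    ∀ (u : ℝ → ℝ³ → ℝ³) (p : ℝ → ℝ³ → ℝ) (G : ℝ → ℝ³ → ℝ³ →L[ℝ] ℝ³) (C : ℝ), 0 < C →
      IsSuitableWeakSolutionOn 𝕊 1 0 u p → HasWeakSpatialGradientOn 𝕊 u G →
      typeIBound (Iio (0 : ℝ) ×ˢ univ) u p G < ⊤ → HasTypeIDecay C u →
      ∃ V : ℝ → ℝ³ → ℝ³,
        uncurry V =ᵐ[volume.restrict (Iio (0 : ℝ) ×ˢ (univ : Set ℝ³))] uncurry u ∧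
        IsTypeIAncientMild C V ∧ HasTypeIDecay C V := by
  sorry

/-- **S1β — scale-invariant derivative and pressure bounds for Type-I ancient mild apex profiles.**
A Type-I ancient mild field with the apex bound is a classical solution of Navier–Stokes on the open slab
with a (Leray-gauge) pressure `Q`, and for some `L ≥ 0`:
`‖∇V‖ ≤ L/(‖x‖+√−t)²`, `‖∇²V‖, ‖∂ₜV‖, ‖∇Q‖ ≤ L/(‖x‖+√−t)³`, `|Q| ≤ L/(‖x‖+√−t)²`.
Sources: KNSS 2009 Prop. 4.1 / Seregin 2014 Prop. 3.9 (smoothing of bounded mild solutions at the parabolic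
scale), CKN/Seregin–Šverák 2009 §2 local higher regularity at scale `‖x‖` (tree:
`NSBoundedHigherRegularityBounds_holds`, `exists_epsilonRegularity_top`, `KNSSMildRegularity*`,
`KNSSMildGradientBound`, `KNSSMildRegularityTime`), pressure `Q = ℛℛ(V⊗V)` off-diagonal kernel bounds. -/
theorem stub_apexDerivativeBounds :
    ∀ (V : ℝ → ℝ³ → ℝ³) (C : ℝ), 0 < C → IsTypeIAncientMild C V → HasTypeIDecay C V →
      ∃ (Q : ℝ → ℝ³ → ℝ) (L : ℝ), 0 ≤ L ∧ IsClassicalNSSolutionOn (Iio (0 : ℝ)) 1 0 V Q ∧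
        (∀ t < 0, ∀ x : ℝ³, ‖fderiv ℝ (V t) x‖ ≤ L / (‖x‖ + Real.sqrt (-t)) ^ 2) ∧
        (∀ t < 0, ∀ x : ℝ³, ‖iteratedFDeriv ℝ 2 (V t) x‖ ≤ L / (‖x‖ + Real.sqrt (-t)) ^ 3) ∧
        (∀ t < 0, ∀ x : ℝ³, ‖deriv (fun s => V s x) t‖ ≤ L / (‖x‖ + Real.sqrt (-t)) ^ 3) ∧
        (∀ t < 0, ∀ x : ℝ³, |Q t x| ≤ L / (‖x‖ + Real.sqrt (-t)) ^ 2) ∧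
        (∀ t < 0, ∀ x : ℝ³, ‖gradient (Q t) x‖ ≤ L / (‖x‖ + Real.sqrt (-t)) ^ 3) := by
  sorry

/-- **S1b — the scar makes the twins polynomially close off the apex.**  If `V₁, V₂` are jointly smooth
representatives of `u₁, u₂` with `‖∂ₜVᵢ‖ ≤ Lᵢ/(‖x‖+√−t)³` and `u₁, u₂` have the same scar, then
`‖V₁(t,x) − V₂(t,x)‖ ≤ (L₁+L₂)(−t)/‖x‖³` for all `t < 0`, `x ≠ 0`: the continuous representatives agree in
the limit `t ↑ 0` at every `x ≠ 0` (ess-sup smallness on `(−δ,0) × K` plus continuity), and one integrates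
the time derivative. [folklore] -/
theorem stub_farFieldOfScar :
    ∀ (u₁ u₂ V₁ V₂ : ℝ → ℝ³ → ℝ³) (L₁ L₂ : ℝ),
      IsSmoothSpaceTimeOn (Iio (0 : ℝ)) V₁ → IsSmoothSpaceTimeOn (Iio (0 : ℝ)) V₂ →
      uncurry V₁ =ᵐ[volume.restrict (Iio (0 : ℝ) ×ˢ (univ : Set ℝ³))] uncurry u₁ →
      uncurry V₂ =ᵐ[volume.restrict (Iio (0 : ℝ) ×ˢ (univ : Set ℝ³))] uncurry u₂ →
      (∀ t < 0, ∀ x : ℝ³, ‖deriv (fun s => V₁ s x) t‖ ≤ L₁ / (‖x‖ + Real.sqrt (-t)) ^ 3) →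
      (∀ t < 0, ∀ x : ℝ³, ‖deriv (fun s => V₂ s x) t‖ ≤ L₂ / (‖x‖ + Real.sqrt (-t)) ^ 3) →
      SameScar u₁ u₂ →
      ∀ t < 0, ∀ x : ℝ³, x ≠ 0 → ‖V₁ t x - V₂ t x‖ ≤ (L₁ + L₂) * (-t) / ‖x‖ ^ 3 := by
  sorry

/-- **S2 — finite energy of a scar-sharing pair, with pure-scaling rates.**  From the apex bound on
both fields, the gradient bounds and the far-field bound `‖V₁−V₂‖ ≤ K(−t)/‖x‖³` (`x ≠ 0`): the single
majorant `‖V₁−V₂‖ ≤ K'(−t)/(‖x‖+√−t)³` and, by the substitution `x = √(−t)·y`,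
`‖(V₁−V₂)(t)‖_{L²} ≤ K'|t|^{1/4}`, `‖(V₁−V₂)(t)‖_{L^{6/5}} ≤ K'|t|^{3/4}`, `‖∇(V₁−V₂)(t)‖_{L²} ≤ K'|t|^{−1/4}`
for every `t < 0` (the profiles `(1+‖y‖)^{−6}`, `(1+‖y‖)^{−18/5}`, `(1+‖y‖)^{−4}` are integrable on `ℝ³`).
[folklore] -/
theorem stub_twinNorms :
    ∀ (V₁ V₂ : ℝ → ℝ³ → ℝ³) (C L₁ L₂ K : ℝ), HasTypeIDecay C V₁ → HasTypeIDecay C V₂ →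
      (∀ t < 0, ∀ x : ℝ³, ‖fderiv ℝ (V₁ t) x‖ ≤ L₁ / (‖x‖ + Real.sqrt (-t)) ^ 2) →
      (∀ t < 0, ∀ x : ℝ³, ‖fderiv ℝ (V₂ t) x‖ ≤ L₂ / (‖x‖ + Real.sqrt (-t)) ^ 2) →
      (∀ t < 0, ∀ x : ℝ³, x ≠ 0 → ‖V₁ t x - V₂ t x‖ ≤ K * (-t) / ‖x‖ ^ 3) →
      ∃ K' : ℝ, 0 ≤ K' ∧ ∀ t < 0,
        (∀ x : ℝ³, ‖V₁ t x - V₂ t x‖ ≤ K' * (-t) / (‖x‖ + Real.sqrt (-t)) ^ 3) ∧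
        eLpNorm (fun x => V₁ t x - V₂ t x) 2 volume ≤ ENNReal.ofReal (K' * (-t) ^ ((1 : ℝ) / 4)) ∧
        eLpNorm (fun x => V₁ t x - V₂ t x) ((6 : ℝ≥0∞) / 5) volume ≤
          ENNReal.ofReal (K' * (-t) ^ ((3 : ℝ) / 4)) ∧
        eLpNorm (fun x => fderiv ℝ (V₁ t) x - fderiv ℝ (V₂ t) x) 2 volume ≤
          ENNReal.ofReal (K' * (-t) ^ (-(1 : ℝ) / 4)) := by
  sorry

/-- **S4 — log-convexity below the threshold `2C² < 1` (the line's theorem; no singularity hypothesis).**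
Two classical Navier–Stokes solutions on the open slab with the apex bound at constant `C`, the
scale-invariant derivative/pressure bounds of S1β and the twin smallness/finite-energy package of S2
coincide when `2C² < 1`: in `H = Ḣ⁻¹_σ(ℝ³)` with `A` the Stokes operator, `w = V₁ − V₂` solves
`ẇ + Aw = −ℙ∇·(w⊗V₁ + V₂⊗w)` with `‖ℙ∇·(w⊗V₁+V₂⊗w)‖_H ≤ (2C/√|t|)‖A^{1/2}w‖_H`; the frequency
`Λ = ‖A^{1/2}w‖²/‖w‖²` obeys `Λ̇ ≤ 2C²Λ/|t|`, so `Λ ≤ M|t|^{−2C²}` and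
`d/dt log ‖w‖²_H ≥ −2Λ − (4C/√|t|)Λ^{1/2}` is integrable up to `t = 0` iff `2C² < 1`; hence `w(t₀) ≠ 0`
forces `inf ‖w(t)‖_H > 0`, contradicting `‖w(t)‖_{Ḣ⁻¹} ≲ ‖w(t)‖_{L^{6/5}} ≤ K'|t|^{3/4} → 0`.
Sources: Agmon–Nirenberg 1967 / Ogawa 1965 (log-convexity), Miller 1974 (sharpness of thresholds in the
abstract frame), TRIAGE r1-1 O1–O2, r1-3. -/
theorem stub_logConvexityBelowThreshold :
    ∀ (V₁ V₂ : ℝ → ℝ³ → ℝ³) (Q₁ Q₂ : ℝ → ℝ³ → ℝ) (C L₁ L₂ K' : ℝ), 0 < C → 2 * C ^ 2 < 1 →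
      IsClassicalNSSolutionOn (Iio (0 : ℝ)) 1 0 V₁ Q₁ → IsClassicalNSSolutionOn (Iio (0 : ℝ)) 1 0 V₂ Q₂ →
      HasTypeIDecay C V₁ → HasTypeIDecay C V₂ →
      (∀ t < 0, ∀ x : ℝ³, ‖fderiv ℝ (V₁ t) x‖ ≤ L₁ / (‖x‖ + Real.sqrt (-t)) ^ 2) →
      (∀ t < 0, ∀ x : ℝ³, ‖iteratedFDeriv ℝ 2 (V₁ t) x‖ ≤ L₁ / (‖x‖ + Real.sqrt (-t)) ^ 3) →
      (∀ t < 0, ∀ x : ℝ³, ‖deriv (fun s => V₁ s x) t‖ ≤ L₁ / (‖x‖ + Real.sqrt (-t)) ^ 3) →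
      (∀ t < 0, ∀ x : ℝ³, |Q₁ t x| ≤ L₁ / (‖x‖ + Real.sqrt (-t)) ^ 2) →
      (∀ t < 0, ∀ x : ℝ³, ‖gradient (Q₁ t) x‖ ≤ L₁ / (‖x‖ + Real.sqrt (-t)) ^ 3) →
      (∀ t < 0, ∀ x : ℝ³, ‖fderiv ℝ (V₂ t) x‖ ≤ L₂ / (‖x‖ + Real.sqrt (-t)) ^ 2) →
      (∀ t < 0, ∀ x : ℝ³, ‖iteratedFDeriv ℝ 2 (V₂ t) x‖ ≤ L₂ / (‖x‖ + Real.sqrt (-t)) ^ 3) →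
      (∀ t < 0, ∀ x : ℝ³, ‖deriv (fun s => V₂ s x) t‖ ≤ L₂ / (‖x‖ + Real.sqrt (-t)) ^ 3) →
      (∀ t < 0, ∀ x : ℝ³, |Q₂ t x| ≤ L₂ / (‖x‖ + Real.sqrt (-t)) ^ 2) →
      (∀ t < 0, ∀ x : ℝ³, ‖gradient (Q₂ t) x‖ ≤ L₂ / (‖x‖ + Real.sqrt (-t)) ^ 3) →
      (∀ t < 0,
        (∀ x : ℝ³, ‖V₁ t x - V₂ t x‖ ≤ K' * (-t) / (‖x‖ + Real.sqrt (-t)) ^ 3) ∧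
        eLpNorm (fun x => V₁ t x - V₂ t x) 2 volume ≤ ENNReal.ofReal (K' * (-t) ^ ((1 : ℝ) / 4)) ∧
        eLpNorm (fun x => V₁ t x - V₂ t x) ((6 : ℝ≥0∞) / 5) volume ≤
          ENNReal.ofReal (K' * (-t) ^ ((3 : ℝ) / 4)) ∧
        eLpNorm (fun x => fderiv ℝ (V₁ t) x - fderiv ℝ (V₂ t) x) 2 volume ≤
          ENNReal.ofReal (K' * (-t) ^ (-(1 : ℝ) / 4))) →
      ∀ t < 0, ∀ x : ℝ³, V₁ t x = V₂ t x := by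
  sorry

/-- **S5 — NO ANOMALOUS EXTINCTION (the OPEN residual of the line = the crux on `1 ≤ 2C²`).**
Above the threshold the abstract log-convexity frame `ẇ + Aw = B(t)w`, `‖B(t)‖_{D(A^{1/2})→H} ≤ 2C|t|^{−1/2}`
admits extinction at `t = 0` (Miller 1974), so a Navier–Stokes-specific lever acting on the parabolic core at
arbitrary Type-I constant is required; none is known (TRIAGE r1-1 O3, r1-2 bottom line, r1-3 S4).  By S1α–S4
the finite-energy ticket (`‖w(t)‖_{Ḣ⁻¹} ≲ |t|^{3/4}`, `w(t) ∈ L² ∩ Ḣ¹`) is pre-paid for any attack. -/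
theorem stub_noAnomalousExtinction : ∀ C : ℝ, 1 ≤ 2 * C ^ 2 → ScarRigidityAt C := by
  sorry

/-! ## Composition -/

/-- A pointwise statement on `t < 0` holds a.e. on the slab `Iio 0 ×ˢ univ`. [folklore] -/
theorem ae_slab_of_forall {P : ℝ × ℝ³ → Prop} (h : ∀ t < 0, ∀ x : ℝ³, P (t, x)) :
    ∀ᵐ z ∂(volume.restrict (Iio (0 : ℝ) ×ˢ (univ : Set ℝ³))), P z := by
  filter_upwards [ae_restrict_mem (measurableSet_Iio.prod MeasurableSet.univ)] with z hz
  exact h z.1 (mem_prod.1 hz).1 z.2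

/-- **The line closes the crux modulo its stubs**: `ScarRigidity` from S1α, S1β, S1b, S2, S4 (the
threshold theorem on `2C² < 1`) and the residual S5 (`1 ≤ 2C²`), via the normal form
`scarRigidity_iff_pos` (only `0 < C` carries content). -/
theorem ScarRigidity_of : ScarRigidity := by
  rw [scarRigidity_iff_pos]
  intro C hC
  by_cases hthr : 2 * C ^ 2 < 1
  · intro u₁ p₁ G₁ u₂ p₂ G₂ hs₁ hg₁ hI₁ hd₁ hs₂ hg₂ hI₂ hd₂ _ _ hscar
    obtain ⟨V₁, hae₁, hm₁, hdV₁⟩ := stub_apexMildRepresentative u₁ p₁ G₁ C hC hs₁ hg₁ hI₁ hd₁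
    obtain ⟨V₂, hae₂, hm₂, hdV₂⟩ := stub_apexMildRepresentative u₂ p₂ G₂ C hC hs₂ hg₂ hI₂ hd₂
    obtain ⟨Q₁, L₁, hL₁, hcl₁, hg₁', hh₁, ht₁, hq₁, hgq₁⟩ := stub_apexDerivativeBounds V₁ C hC hm₁ hdV₁
    obtain ⟨Q₂, L₂, hL₂, hcl₂, hg₂', hh₂, ht₂, hq₂, hgq₂⟩ := stub_apexDerivativeBounds V₂ C hC hm₂ hdV₂
    have hfar := stub_farFieldOfScar u₁ u₂ V₁ V₂ L₁ L₂ hcl₁.smooth_velocity hcl₂.smooth_velocity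
      hae₁ hae₂ ht₁ ht₂ hscar
    obtain ⟨K', _, hK'⟩ := stub_twinNorms V₁ V₂ C L₁ L₂ (L₁ + L₂) hdV₁ hdV₂ hg₁' hg₂' hfar
    have heq := stub_logConvexityBelowThreshold V₁ V₂ Q₁ Q₂ C L₁ L₂ K' hC hthr hcl₁ hcl₂ hdV₁ hdV₂
      hg₁' hh₁ ht₁ hq₁ hgq₁ hg₂' hh₂ ht₂ hq₂ hgq₂ hK'
    -- `u₁ = V₁ = V₂ = u₂` a.e. on the slab
    have hV : uncurry V₁ =ᵐ[volume.restrict (Iio (0 : ℝ) ×ˢ (univ : Set ℝ³))] uncurry V₂ :=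
      ae_slab_of_forall (P := fun z => uncurry V₁ z = uncurry V₂ z) fun t ht x => heq t ht x
    exact (hae₁.symm.trans hV).trans hae₂
  · exact stub_noAnomalousExtinction C (not_lt.1 hthr)

/-- The crux, by name (gate shape `theorem … : <route decl>`). -/
theorem scarRigidity_proof : ScarRigidity := ScarRigidity_of

end Summit.NavierStokesRegularity.NavierStokesRegularity.Theorems.RellichScarScarRigidity

end
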